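import Mathlib
import HarnessLib
import Summits.RiemannHypothesis.RiemannHypothesis.Theorems.IntegerScrewCouplingDefs
import Summits.RiemannHypothesis.RiemannHypothesis.Theorems.IntegerScrewResolventVariational
import Summits.RiemannHypothesis.RiemannHypothesis.Theorems.IntegerScrewVonMangoldtCoupling
import Summits.RiemannHypothesis.RiemannHypothesis.Theorems.IntegerScrewVonMangoldtCouplingSharp

/-!
# Route `IntegerScrew` — the coupling matrix `N_M` as a matrix: `cᵀN_Mc = 2B_M(c)`, symmetry, the form bounds
# `ν_max(N_M) ≤ log M + 6` / `≤ log M − γ + o(1)` in matrix language, and the WINDOW FLOOR as a resolvent entry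
# `f_M(a) = 1/[(aI − N_M)⁻¹]₁₁` (PIVOT-LAW 13.1, 13.3, 13.10 (v))

Bridge between the tree's double-sum vocabulary for the von Mangoldt coupling form
(`IntegerScrewVonMangoldtCoupling*`: LEMMA N (i), PROP. N2) and the matrix `couplingMatrix M`
(`IntegerScrewCouplingDefs`), so that the generic resolvent identities (`IntegerScrewResolventVariational`,
`IntegerScrewResolventLaplace`) apply to the window floor `windowFloor M a` of PIVOT-LAW §13:

* `couplingMatrix_apply_eq_add`, `couplingMatrix_transpose`, `couplingMatrix_isHermitian` — `N_M` is the
  symmetrisation of the «multiples» kernel `U(k, kn) = Λ(n)/√n`;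
* `dotProduct_couplingMatrix_mulVec` — `cᵀN_Mc = 2·Σ_{m ≤ M}Σ_{n ≤ M/m} Λ(n) n^{−1/2} c_{mn} c_m` (PIVOT-LAW 13.1);
* `couplingMatrix_form_le_log_add_six` (all `M`: `cᵀN_Mc ≤ (log M + 6)‖c‖²`, from LEMMA N (i)) and
  `couplingMatrix_form_le_eventually` (`cᵀN_Mc ≤ (log M − γ + δ)‖c‖²` for large `M`, from PROP. N2);
* `couplingWindowForm_eq_matrixForm`, `windowFloor_eq_inv_resolvent` — for `aI − N_M ≻ 0` the floor is
  attained and `f_M(a) = 1/[(aI − N_M)⁻¹]₁₁ > 0`; `windowMatrix_posDef_of_log_add_six_lt` (`a > log M + 6`)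
  and `windowMatrix_posDef_eventually` (`a = log M + s`, `s ≥ 0`, `M` large) supply the hypothesis.

RH-free: `N_M` is an arithmetic matrix; nothing here bears on the truth of RH.  References: PIVOT-LAW §13.1,
§13.3, §13.10 (v), §13.45 (rh-explicit A6-PIVOT); M. Suzuki, J. Lond. Math. Soc. (2) 108 (2023) 1448–1487
[Suzuki2023] for the screw matrices.
-/

noncomputable section

-- D-0017: `Summit.<S>.<S>.…` is the designed namespace of a single-problem summit.
set_option linter.dupNamespace false

namespace Summit.RiemannHypothesis.RiemannHypothesis.Theorems.IntegerScrew

open Matrix Finset ArithmeticFunction Filter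

/-! ### Entries and symmetry -/

/-- The entries of `N_M` as «multiple» part plus its transpose: `(N_M)_{kj} = U(k,j) + U(j,k)` with
`U(k,j) = Λ(j/k)/√(j/k)` if `k ∣ j` and `0` otherwise (at `k = j` both terms are `Λ(1) = 0`). -/
theorem couplingMatrix_apply_eq_add {M : ℕ} (k j : ↥(Finset.Icc 1 M)) :
    couplingMatrix M k j =
      (if (k : ℕ) ∣ (j : ℕ) then Λ ((j : ℕ) / (k : ℕ)) / Real.sqrt (((j : ℕ) / (k : ℕ) : ℕ) : ℝ) else 0) +
      (if (j : ℕ) ∣ (k : ℕ) then Λ ((k : ℕ) / (j : ℕ)) / Real.sqrt (((k : ℕ) / (j : ℕ) : ℕ) : ℝ) else 0) := by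
  have hk : 1 ≤ (k : ℕ) := (Finset.mem_Icc.1 k.2).1
  rw [couplingMatrix, Matrix.of_apply]
  by_cases hkj : (k : ℕ) = (j : ℕ)
  · -- diagonal: every term is Λ(1)/√1 = 0
    have hkj' : k = j := Subtype.ext hkj
    subst hkj'
    have hdiv : (k : ℕ) / (k : ℕ) = 1 := Nat.div_self hk
    rw [if_pos dvd_rfl, if_pos dvd_rfl, hdiv, vonMangoldt_apply_one, zero_div, add_zero]
  · by_cases h1 : (k : ℕ) ∣ (j : ℕ)
    · have h2 : ¬ (j : ℕ) ∣ (k : ℕ) := fun h => hkj (Nat.dvd_antisymm h1 h)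
      rw [if_pos h1, if_pos h1, if_neg h2, add_zero]
    · rw [if_neg h1, if_neg h1, zero_add]

/-- `N_M` is symmetric. -/
theorem couplingMatrix_transpose (M : ℕ) : (couplingMatrix M)ᵀ = couplingMatrix M := by
  ext k j
  rw [transpose_apply, couplingMatrix_apply_eq_add, couplingMatrix_apply_eq_add, add_comm]

/-- `N_M` is Hermitian (real symmetric). -/
theorem couplingMatrix_isHermitian (M : ℕ) : (couplingMatrix M).IsHermitian := by
  rw [IsHermitian, conjTranspose_eq_transpose_of_trivial, couplingMatrix_transpose]

/-! ### The quadratic form is twice the coupling form -/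

/-- The «multiples» kernel applied to a vector: `Σ_{j ≤ M, k ∣ j} Λ(j/k)/√(j/k)·c_j = Σ_{n ≤ M/k} Λ(n)/√n·c_{kn}`. -/
theorem sum_multiples_kernel_eq {M k : ℕ} (hk : 1 ≤ k) (c : ℕ → ℝ) :
    ∑ j ∈ Finset.Icc 1 M,
        (if k ∣ j then Λ (j / k) / Real.sqrt ((j / k : ℕ) : ℝ) else 0) * c j =
      ∑ n ∈ Finset.Icc 1 (M / k), Λ n / Real.sqrt n * c (k * n) := by
  rw [← Finset.sum_filter_add_sum_filter_not (Finset.Icc 1 M) (fun j => k ∣ j)]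
  have hzero : ∑ j ∈ (Finset.Icc 1 M).filter (fun j => ¬ k ∣ j),
      (if k ∣ j then Λ (j / k) / Real.sqrt ((j / k : ℕ) : ℝ) else 0) * c j = 0 := by
    refine Finset.sum_eq_zero fun j hj => ?_
    rw [Finset.mem_filter] at hj
    rw [if_neg hj.2, zero_mul]
  rw [hzero, add_zero]
  have hcongr : ∑ j ∈ (Finset.Icc 1 M).filter (fun j => k ∣ j),
      (if k ∣ j then Λ (j / k) / Real.sqrt ((j / k : ℕ) : ℝ) else 0) * c j =
      ∑ j ∈ (Finset.Icc 1 M).filter (fun j => k ∣ j), Λ (j / k) / Real.sqrt ((j / k : ℕ) : ℝ) * c j := by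
    refine Finset.sum_congr rfl fun j hj => ?_
    rw [if_pos (Finset.mem_filter.1 hj).2]
  -- reindex the multiples of `k` by `n = j/k` (as in `IntegerScrewParityGap.sum_Icc_filter_dvd_eq`)
  have hk0 : k ≠ 0 := by omega
  have hset : (Finset.Icc 1 M).filter (fun j => k ∣ j) =
      (Finset.Icc 1 (M / k)).map ⟨fun n => k * n, mul_right_injective₀ hk0⟩ := by
    ext j
    simp only [Finset.mem_filter, Finset.mem_Icc, Finset.mem_map, Function.Embedding.coeFn_mk]
    constructor
    · rintro ⟨⟨h1, h2⟩, ⟨n, rfl⟩⟩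
      refine ⟨n, ⟨?_, ?_⟩, rfl⟩
      · rcases Nat.eq_zero_or_pos n with h | h
        · subst h; simp at h1
        · exact h
      · exact (Nat.le_div_iff_mul_le hk).2 (by rw [mul_comm]; exact h2)
    · rintro ⟨n, ⟨h1, h2⟩, rfl⟩
      refine ⟨⟨Nat.one_le_iff_ne_zero.2 (Nat.mul_ne_zero hk0 (by omega)), ?_⟩, dvd_mul_right k n⟩
      have := (Nat.le_div_iff_mul_le hk).1 h2
      rwa [mul_comm] at this
  rw [hcongr, hset, Finset.sum_map]
  refine Finset.sum_congr rfl fun n _ => ?_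
  simp only [Function.Embedding.coeFn_mk]
  rw [Nat.mul_div_cancel_left n (Nat.pos_of_ne_zero hk0)]

/-- **`cᵀN_Mc = 2B_M(c)`** (PIVOT-LAW 13.1): the quadratic form of the coupling matrix on the restriction of a
real sequence `c` to `{1, …, M}` is twice the tree's coupling form. -/
theorem dotProduct_couplingMatrix_mulVec (M : ℕ) (c : ℕ → ℝ) :
    (fun k : ↥(Finset.Icc 1 M) => c k) ⬝ᵥ (couplingMatrix M *ᵥ fun k : ↥(Finset.Icc 1 M) => c k) =
      2 * ∑ m ∈ Icc 1 M, ∑ n ∈ Icc 1 (M / m), Λ n / Real.sqrt n * (c (m * n) * c m) := by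
  -- the «multiples» kernel as a function of two naturals
  set U : ℕ → ℕ → ℝ := fun k j => if k ∣ j then Λ (j / k) / Real.sqrt ((j / k : ℕ) : ℝ) else 0 with hU
  have happly : ∀ k j : ↥(Finset.Icc 1 M), couplingMatrix M k j = U k j + U j k := fun k j => by
    rw [couplingMatrix_apply_eq_add]
  -- the single sum Σ_k c_k Σ_j U(k,j) c_j equals B_M(c)
  have hsingle : ∑ k : ↥(Finset.Icc 1 M), c k * ∑ j : ↥(Finset.Icc 1 M), U k j * c j =
      ∑ m ∈ Icc 1 M, ∑ n ∈ Icc 1 (M / m), Λ n / Real.sqrt n * (c (m * n) * c m) := by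
    rw [Finset.sum_coe_sort (Finset.Icc 1 M) (fun k => c k * ∑ j : ↥(Finset.Icc 1 M), U k j * c j)]
    refine Finset.sum_congr rfl fun m hm => ?_
    have hm1 : 1 ≤ m := (Finset.mem_Icc.1 hm).1
    rw [Finset.sum_coe_sort (Finset.Icc 1 M) (fun j => U m j * c j)]
    rw [show (∑ j ∈ Finset.Icc 1 M, U m j * c j) =
        ∑ j ∈ Finset.Icc 1 M, (if m ∣ j then Λ (j / m) / Real.sqrt ((j / m : ℕ) : ℝ) else 0) * c j
        from rfl, sum_multiples_kernel_eq hm1 c, Finset.mul_sum]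
    refine Finset.sum_congr rfl fun n _ => ?_
    ring
  -- assemble: Σ_k Σ_j c_k (U_kj + U_jk) c_j = 2 Σ_k Σ_j c_k U_kj c_j
  have hform : (fun k : ↥(Finset.Icc 1 M) => c k) ⬝ᵥ (couplingMatrix M *ᵥ fun k : ↥(Finset.Icc 1 M) => c k) =
      ∑ k : ↥(Finset.Icc 1 M), ∑ j : ↥(Finset.Icc 1 M), c k * ((U k j + U j k) * c j) := by
    simp only [dotProduct, mulVec, happly, Finset.mul_sum]
  rw [hform]
  have hsplit : ∑ k : ↥(Finset.Icc 1 M), ∑ j : ↥(Finset.Icc 1 M), c k * ((U k j + U j k) * c j) =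
      (∑ k : ↥(Finset.Icc 1 M), ∑ j : ↥(Finset.Icc 1 M), c k * (U k j * c j)) +
        ∑ k : ↥(Finset.Icc 1 M), ∑ j : ↥(Finset.Icc 1 M), c k * (U j k * c j) := by
    rw [← Finset.sum_add_distrib]
    refine Finset.sum_congr rfl fun k _ => ?_
    rw [← Finset.sum_add_distrib]
    refine Finset.sum_congr rfl fun j _ => ?_
    ring
  have hswap : ∑ k : ↥(Finset.Icc 1 M), ∑ j : ↥(Finset.Icc 1 M), c k * (U j k * c j) =
      ∑ k : ↥(Finset.Icc 1 M), ∑ j : ↥(Finset.Icc 1 M), c k * (U k j * c j) := by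
    rw [Finset.sum_comm]
    refine Finset.sum_congr rfl fun k _ => Finset.sum_congr rfl fun j _ => ?_
    ring
  rw [hsplit, hswap, ← two_mul]
  congr 1
  rw [← hsingle]
  refine Finset.sum_congr rfl fun k _ => ?_
  rw [Finset.mul_sum]

/-- `‖c‖²` on the states: `Σ_{k : {1..M}} c_k c_k = Σ_{k ≤ M} c_k²`. -/
theorem dotProduct_self_eq_sum_sq (M : ℕ) (c : ℕ → ℝ) :
    (fun k : ↥(Finset.Icc 1 M) => c k) ⬝ᵥ (fun k : ↥(Finset.Icc 1 M) => c k) = ∑ k ∈ Icc 1 M, c k ^ 2 := by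
  simp only [dotProduct]
  rw [Finset.sum_coe_sort (Finset.Icc 1 M) (fun k => c k * c k)]
  exact Finset.sum_congr rfl fun k _ => by ring

/-- Every vector on the states is the restriction of a sequence (its extension by zero). -/
theorem exists_seq_restrict_eq {M : ℕ} (v : ↥(Finset.Icc 1 M) → ℝ) :
    ∃ c : ℕ → ℝ, (fun k : ↥(Finset.Icc 1 M) => c k) = v ∧
      ∀ k (h : k ∈ Finset.Icc 1 M), c k = v ⟨k, h⟩ := by
  refine ⟨fun k => if h : k ∈ Finset.Icc 1 M then v ⟨k, h⟩ else 0, ?_, fun k h => by simp [h]⟩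
  funext k
  simp [k.2]

/-! ### Form bounds in matrix language -/

/-- **LEMMA N (i) for the matrix**: `cᵀN_Mc ≤ (log M + 6)·‖c‖²` for every `M` and every real `c`. -/
theorem couplingMatrix_form_le_log_add_six (M : ℕ) (v : ↥(Finset.Icc 1 M) → ℝ) :
    v ⬝ᵥ (couplingMatrix M *ᵥ v) ≤ (Real.log M + 6) * (v ⬝ᵥ v) := by
  obtain ⟨c, hc, -⟩ := exists_seq_restrict_eq v
  rw [← hc, dotProduct_couplingMatrix_mulVec, dotProduct_self_eq_sum_sq]
  exact (le_abs_self _).trans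
    (by simpa [mul_comm] using two_mul_abs_vonMangoldtCoupling_le_log M c)

/-- **PROP. N2 (upper half) for the matrix**: for every `δ > 0`, for all large `M` and every real `c`,
`cᵀN_Mc ≤ (log M − γ + δ)·‖c‖²`, i.e. `ν_max(N_M) ≤ log M − γ + o(1)`. -/
theorem couplingMatrix_form_le_eventually {δ : ℝ} (hδ : 0 < δ) :
    ∀ᶠ M : ℕ in atTop, ∀ v : ↥(Finset.Icc 1 M) → ℝ,
      v ⬝ᵥ (couplingMatrix M *ᵥ v) ≤ (Real.log M - Real.eulerMascheroniConstant + δ) * (v ⬝ᵥ v) := by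
  filter_upwards [two_mul_abs_vonMangoldtCoupling_le_eventually hδ] with M hM v
  obtain ⟨c, hc, -⟩ := exists_seq_restrict_eq v
  rw [← hc, dotProduct_couplingMatrix_mulVec, dotProduct_self_eq_sum_sq]
  have h := hM c
  have h2 := le_abs_self (∑ m ∈ Icc 1 M, ∑ n ∈ Icc 1 (M / m), Λ n / Real.sqrt n * (c (m * n) * c m))
  linarith

/-- `aI − N_M ≻ 0` whenever `a > log M + 6` (every `M`). -/
theorem windowMatrix_posDef_of_log_add_six_lt (M : ℕ) {a : ℝ} (ha : Real.log M + 6 < a) :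
    (a • (1 : Matrix ↥(Finset.Icc 1 M) ↥(Finset.Icc 1 M) ℝ) - couplingMatrix M).PosDef :=
  windowMatrix_posDef_of_form_le _ (couplingMatrix_isHermitian M) (couplingMatrix_form_le_log_add_six M) ha

/-- `(log M + s)I − N_M ≻ 0` for every `s ≥ 0` once `M` is large (PROP. N2: `ν_max(N_M) ≤ log M − γ/2`
eventually, and `γ > 0`). -/
theorem windowMatrix_posDef_eventually :
    ∀ᶠ M : ℕ in atTop, ∀ s : ℝ, 0 ≤ s →
      ((Real.log M + s) • (1 : Matrix ↥(Finset.Icc 1 M) ↥(Finset.Icc 1 M) ℝ) - couplingMatrix M).PosDef := by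
  have hγ : 0 < Real.eulerMascheroniConstant := by
    linarith [Real.one_half_lt_eulerMascheroniConstant]
  filter_upwards [couplingMatrix_form_le_eventually (half_pos hγ)] with M hM s hs
  refine windowMatrix_posDef_of_form_le _ (couplingMatrix_isHermitian M) (hM) ?_
  linarith

/-! ### The window form and the window floor through the matrix -/

/-- The window form of a sequence is the quadratic form of `aI − N_M` on its restriction:
`Q_a(c) = a‖c‖² − cᵀN_Mc`. -/
theorem couplingWindowForm_eq_matrixForm (M : ℕ) (a : ℝ) (c : ℕ → ℝ) :
    couplingWindowForm M a c =
      a * ((fun k : ↥(Finset.Icc 1 M) => c k) ⬝ᵥ fun k : ↥(Finset.Icc 1 M) => c k) -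
        (fun k : ↥(Finset.Icc 1 M) => c k) ⬝ᵥ (couplingMatrix M *ᵥ fun k : ↥(Finset.Icc 1 M) => c k) := by
  rw [couplingWindowForm, dotProduct_couplingMatrix_mulVec, dotProduct_self_eq_sum_sq]

/-- The set of window-form values over `{c_1 = 1}` equals the set of values of the matrix window form over
state vectors with first coordinate `1`. -/
theorem windowFloor_set_eq {M : ℕ} (h1 : 1 ∈ Finset.Icc 1 M) (a : ℝ) :
    {q : ℝ | ∃ c : ℕ → ℝ, c 1 = 1 ∧ couplingWindowForm M a c = q} =
      {q : ℝ | ∃ v : ↥(Finset.Icc 1 M) → ℝ, v ⟨1, h1⟩ = 1 ∧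
        a * (v ⬝ᵥ v) - v ⬝ᵥ (couplingMatrix M *ᵥ v) = q} := by
  ext q
  simp only [Set.mem_setOf_eq]
  constructor
  · rintro ⟨c, hc1, rfl⟩
    exact ⟨fun k => c k, hc1, (couplingWindowForm_eq_matrixForm M a c).symm⟩
  · rintro ⟨v, hv1, rfl⟩
    obtain ⟨c, hc, hck⟩ := exists_seq_restrict_eq v
    refine ⟨c, ?_, ?_⟩
    · rw [hck 1 h1, hv1]
    · rw [couplingWindowForm_eq_matrixForm, hc]

/-- **The window floor is a resolvent entry** (PIVOT-LAW 13.10 (v)): if `aI − N_M ≻ 0` then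
`f_M(a) = 1/[(aI − N_M)⁻¹]₁₁`. -/
theorem windowFloor_eq_inv_resolvent {M : ℕ} (h1 : 1 ∈ Finset.Icc 1 M) {a : ℝ}
    (ha : (a • (1 : Matrix ↥(Finset.Icc 1 M) ↥(Finset.Icc 1 M) ℝ) - couplingMatrix M).PosDef) :
    windowFloor M a =
      (((a • (1 : Matrix ↥(Finset.Icc 1 M) ↥(Finset.Icc 1 M) ℝ) - couplingMatrix M)⁻¹) ⟨1, h1⟩ ⟨1, h1⟩)⁻¹ := by
  rw [windowFloor, windowFloor_set_eq h1]
  exact (isLeast_windowForm (couplingMatrix M) ha ⟨1, h1⟩).csInf_eq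

/-- The window floor is ATTAINED and is the least value of the window form (for `aI − N_M ≻ 0`). -/
theorem isLeast_windowFloor {M : ℕ} (h1 : 1 ∈ Finset.Icc 1 M) {a : ℝ}
    (ha : (a • (1 : Matrix ↥(Finset.Icc 1 M) ↥(Finset.Icc 1 M) ℝ) - couplingMatrix M).PosDef) :
    IsLeast {q : ℝ | ∃ c : ℕ → ℝ, c 1 = 1 ∧ couplingWindowForm M a c = q} (windowFloor M a) := by
  rw [windowFloor_eq_inv_resolvent h1 ha, windowFloor_set_eq h1]
  exact isLeast_windowForm (couplingMatrix M) ha ⟨1, h1⟩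

/-- Hence every `c` with `c_1 = 1` has `Q_a(c) ≥ f_M(a)` (for `aI − N_M ≻ 0`). -/
theorem windowFloor_le_couplingWindowForm {M : ℕ} (h1 : 1 ∈ Finset.Icc 1 M) {a : ℝ}
    (ha : (a • (1 : Matrix ↥(Finset.Icc 1 M) ↥(Finset.Icc 1 M) ℝ) - couplingMatrix M).PosDef)
    {c : ℕ → ℝ} (hc : c 1 = 1) : windowFloor M a ≤ couplingWindowForm M a c :=
  (isLeast_windowFloor h1 ha).2 ⟨c, hc, rfl⟩

/-- The window floor is positive when `aI − N_M ≻ 0`. -/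
theorem windowFloor_pos {M : ℕ} (h1 : 1 ∈ Finset.Icc 1 M) {a : ℝ}
    (ha : (a • (1 : Matrix ↥(Finset.Icc 1 M) ↥(Finset.Icc 1 M) ℝ) - couplingMatrix M).PosDef) :
    0 < windowFloor M a := by
  rw [windowFloor_eq_inv_resolvent h1 ha]
  exact inv_pos.2 (inv_apply_self_pos ha _)

end Summit.RiemannHypothesis.RiemannHypothesis.Theorems.IntegerScrew

end
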